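import Mathlib
import HarnessLib

/-!
# Route `RadicialJung`, crux `CleanModels` (stmt-ResolutionOfSingularities-15917), line `Sketch` rev 35, stub 6 `stub_cleanProp44` (X44c),
# `τ = 1` residual, (B5″) algebraization step: `p`-TH POWERS DESCEND along reduced pure extensions with geometrically reduced generic fibre

Seat decomp-res-hand-2 g13 (structural hand).  Where this sits: hand-2 g12's hand argument for (B5″) (memo `Cruxes/CleanModels/Lines/
Sketch-memo-hand2-g12-stubs-5-7.md` §4 (c)) straightens an infinite unbranched chain of maximal-contact births FORMALLY — the leaf `t` is
re-prepared to `t̂ = t + ĝ^p / v` with `ĝ` a power series — and concludes that the formal axis `𝒜̂ ⊆ V(t̂)` algebraizes (excellence) to a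
`Σ_μ`-curve `𝒜 = V(𝔮)` through `c`; to contradict the `o`-priority of the strategy one needs `𝒜` inside an ALGEBRAIC representative
`V(t + g^p / v)` of the leaf class, i.e. that `-v t mod 𝔮`, a `p`-th power in the completion of the excellent local domain `𝒪_{X,c} / 𝔮`, is
already a `p`-th power in `𝒪_{X,c} / 𝔮`.  The same mechanism moves the standing hypothesis «`g₀` is not a `p`-th power» of the crux into
completions.  This file proves the underlying commutative algebra (no schemes, no completions — the instance `B = Â` of a G-ring is
recorded, not typed):

* `one_ne_zero_tensor_adjoinRoot`, `not_isReduced_tensor_adjoinRoot_of_pow_eq` — **the fibre half.**  `K` a commutative ring of prime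
  characteristic `p`, `S` a non-trivial commutative `K`-algebra, `x ∈ K`.  If `S ⊗[K] K[T]/(T^p − x)` is reduced, then `x` is NOT a `p`-th power
  in `S`: for `c^p = x` the element `c ⊗ 1 − 1 ⊗ T̄` is nilpotent (`(c ⊗ 1 − 1 ⊗ T̄)^p = x ⊗ 1 − 1 ⊗ x = 0`), and it is non-zero because its
  coordinates in the `S`-basis `1 ⊗ T̄^i` are `(c, −1, 0, …)`.
* `exists_pow_eq_of_pow_eq_mul_pow` — **the purity half.**  `A` a domain, `B` a reduced `A`-algebra of characteristic `p` which is PURE for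
  principal ideals (`bB ∩ A = bA`, e.g. `B` faithfully flat over `A`: `mem_span_singleton_of_faithfullyFlat`); if `x ∈ A` is a `p`-th power in
  `Frac A` (`a^p = x b^p`, `b ≠ 0`) and a `p`-th power in `B`, then `x` is a `p`-th power in `A` (Frobenius is injective on `B`, so `a = g' b` in
  `B`, hence `b ∣ a` in `A`).
* `exists_pow_eq_of_pow_eq_algebraMap` (`…_of_faithfullyFlat`) — **the descent.**  `A` a domain with fraction field `K`, `B` a reduced pure
  (resp. faithfully flat) `A`-algebra of characteristic `p` with `K ⊗[A] B ≠ 0`, and the generic fibre geometrically reduced against `x^{1/p}`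
  (`(K ⊗[A] B) ⊗[K] K[T]/(T^p − x)` reduced — only asked when `x ∉ K^p`): if `x ∈ A` becomes a `p`-th power in `B`, it is a `p`-th power in `A`.
  Instance (not typed here): `B = Â` for a local domain `A` which is a G-ring (faithfully flat; `Â ⊆ K ⊗_A Â` regular, hence reduced; generic
  formal fibre geometrically regular — ✓ `Literature.AlgebraicGeometry.Resolution.IsGRing`).

Honest framing: OURS, elementary and folklore (cf. Matsumura, *Commutative Ring Theory*, §26 and §32); nothing here proves (B5″), the hypotheses of
✓ `cleanProp44_of_tauOneResidual`, X44c, any case of `CleanModels`, or resolution of singularities in characteristic `p`.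
-/

set_option linter.dupNamespace false -- mandated namespace of this single-conjunct summit

open Polynomial TensorProduct

namespace Summit.ResolutionOfSingularities.ResolutionOfSingularities.Theorems.RadicialJung.CleanModels

/-! ## §1 The fibre half: `x` a `p`-th power in `S` makes `S ⊗_K K[T]/(T^p − x)` non-reduced -/

section Fibre

variable {K S : Type*} [CommRing K] [CommRing S] [Algebra K S]

/-- The power basis `1, T̄, …, T̄^{p-1}` of `K[T]/(T^p − x)` has `p` elements. [folklore] -/
theorem powerBasis'_X_pow_sub_C_dim {p : ℕ} (hp : 0 < p) (x : K) [Nontrivial K] :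
    (AdjoinRoot.powerBasis' (monic_X_pow_sub_C x hp.ne')).dim = p := by
  rw [AdjoinRoot.powerBasis'_dim, natDegree_X_pow_sub_C]

/-- In `K[T]/(T^p − x)`: `T̄^p = x`. [folklore] -/
theorem root_X_pow_sub_C_pow (p : ℕ) (x : K) :
    (AdjoinRoot.root (X ^ p - C x : K[X])) ^ p = algebraMap K _ x := by
  have h := AdjoinRoot.eval₂_root (X ^ p - C x : K[X])
  rw [eval₂_sub, eval₂_X_pow, eval₂_C, sub_eq_zero] at h
  rw [h, AdjoinRoot.algebraMap_eq]

/-- The coordinate of `c ⊗ T̄^j` at the basis vector `1 ⊗ T̄^i` of `S ⊗[K] K[T]/(T^p − x)` is `c` if `i = j` and `0` otherwise.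
[folklore] -/
theorem basis_repr_tmul_pow {p : ℕ} (hp : 0 < p) (x : K) [Nontrivial K] (c : S)
    (i j : Fin (AdjoinRoot.powerBasis' (monic_X_pow_sub_C x hp.ne')).dim) :
    (Algebra.TensorProduct.basis S (AdjoinRoot.powerBasis' (monic_X_pow_sub_C x hp.ne')).basis).repr
        (c ⊗ₜ[K] (AdjoinRoot.root (X ^ p - C x : K[X]) ^ (j : ℕ))) i = if i = j then c else 0 := by
  classical
  have hgen : AdjoinRoot.root (X ^ p - C x : K[X]) ^ (j : ℕ) =
      (AdjoinRoot.powerBasis' (monic_X_pow_sub_C x hp.ne')).basis j := by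
    rw [PowerBasis.basis_eq_pow, AdjoinRoot.powerBasis'_gen]
  rw [hgen, Algebra.TensorProduct.basis_repr_tmul, Module.Basis.repr_self, Finsupp.mapRange_single, map_one,
    Finsupp.smul_single, smul_eq_mul, mul_one, Finsupp.single_apply]
  by_cases h : i = j
  · subst h; simp
  · simp [h, Ne.symm h]

/-- `S ⊗[K] K[T]/(T^p − x)` is non-trivial when `S` is (`p ≥ 1`). [folklore] -/
theorem one_ne_zero_tensor_adjoinRoot {p : ℕ} (hp : 0 < p) (x : K) [Nontrivial S] :
    (1 : S ⊗[K] AdjoinRoot (X ^ p - C x : K[X])) ≠ 0 := by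
  haveI : Nontrivial K := (algebraMap K S).domain_nontrivial
  intro h
  set pb := AdjoinRoot.powerBasis' (monic_X_pow_sub_C x hp.ne')
  have hdim : pb.dim = p := powerBasis'_X_pow_sub_C_dim hp x
  let i0 : Fin pb.dim := ⟨0, by omega⟩
  have h1 := basis_repr_tmul_pow hp x (1 : S) i0 i0
  rw [if_pos rfl] at h1
  have h1' : (1 : S) ⊗ₜ[K] (AdjoinRoot.root (X ^ p - C x : K[X]) ^ ((i0 : ℕ))) = 1 := by
    simp [i0, Algebra.TensorProduct.one_def]
  rw [h1', h, map_zero, Finsupp.zero_apply] at h1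
  exact one_ne_zero h1.symm

/-- **The fibre half.**  `K` a commutative ring of prime characteristic `p`, `S` a non-trivial commutative `K`-algebra, `x ∈ K`, and `c ∈ S`
with `c^p = x`.  Then `S ⊗[K] K[T]/(T^p − x)` is NOT reduced: `c ⊗ 1 − 1 ⊗ T̄` is a non-zero nilpotent.  (Contrapositively: if this fibre
ring is reduced — e.g. `S` geometrically reduced over a field `K` with `x ∉ K^p` — then `x` is not a `p`-th power in `S`.) [folklore] -/
theorem not_isReduced_tensor_adjoinRoot_of_pow_eq (p : ℕ) [hp : Fact p.Prime] [CharP K p] [Nontrivial S] (x : K)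
    {c : S} (hc : c ^ p = algebraMap K S x) :
    ¬ IsReduced (S ⊗[K] AdjoinRoot (X ^ p - C x : K[X])) := by
  haveI : Nontrivial K := (algebraMap K S).domain_nontrivial
  intro hred
  have hp0 : 0 < p := hp.out.pos
  set D := S ⊗[K] AdjoinRoot (X ^ p - C x : K[X])
  -- `D` is non-trivial of characteristic `p`
  haveI : Nontrivial D := nontrivial_of_ne 1 0 (one_ne_zero_tensor_adjoinRoot hp0 x)
  haveI : CharP D p := by
    rw [CharP.charP_iff_prime_eq_zero hp.out]
    have : ((p : ℕ) : D) = algebraMap K D (p : K) := (map_natCast _ p).symm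
    rw [this, CharP.cast_eq_zero, map_zero]
  set r := AdjoinRoot.root (X ^ p - C x : K[X]) with hr
  -- the nilpotent
  have hnil : (c ⊗ₜ[K] (1 : AdjoinRoot (X ^ p - C x : K[X])) - (1 : S) ⊗ₜ[K] r) ^ p = 0 := by
    rw [sub_pow_char, Algebra.TensorProduct.tmul_pow, Algebra.TensorProduct.tmul_pow, one_pow, one_pow, hc,
      root_X_pow_sub_C_pow, Algebra.algebraMap_eq_smul_one, Algebra.algebraMap_eq_smul_one, ← smul_tmul',
      tmul_smul, sub_self]
  have hzero : c ⊗ₜ[K] (1 : AdjoinRoot (X ^ p - C x : K[X])) - (1 : S) ⊗ₜ[K] r = 0 :=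
    hred.eq_zero _ ⟨p, hnil⟩
  -- read the coordinate at `1 ⊗ T̄`
  set pb := AdjoinRoot.powerBasis' (monic_X_pow_sub_C x hp0.ne')
  have hdim : pb.dim = p := powerBasis'_X_pow_sub_C_dim hp0 x
  have h2 : 2 ≤ p := hp.out.two_le
  let i0 : Fin pb.dim := ⟨0, by omega⟩
  let i1 : Fin pb.dim := ⟨1, by omega⟩
  have hne : i1 ≠ i0 := by simp [i0, i1, Fin.ext_iff]
  have hc0 := basis_repr_tmul_pow hp0 x c i1 i0
  rw [if_neg hne] at hc0
  have hr1 := basis_repr_tmul_pow hp0 x (1 : S) i1 i1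
  rw [if_pos rfl] at hr1
  have e0 : c ⊗ₜ[K] (1 : AdjoinRoot (X ^ p - C x : K[X])) = c ⊗ₜ[K] (r ^ ((i0 : ℕ))) := by simp [i0]
  have e1 : (1 : S) ⊗ₜ[K] r = (1 : S) ⊗ₜ[K] (r ^ ((i1 : ℕ))) := by simp [i1]
  rw [sub_eq_zero, e0, e1] at hzero
  rw [hzero, hr1] at hc0
  exact one_ne_zero hc0

/-- Contrapositive form of the fibre half: a reduced fibre ring forbids `p`-th roots of `x` in `S`. [folklore] -/
theorem forall_pow_ne_of_isReduced_tensor_adjoinRoot (p : ℕ) [Fact p.Prime] [CharP K p] [Nontrivial S] (x : K)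
    (hred : IsReduced (S ⊗[K] AdjoinRoot (X ^ p - C x : K[X]))) (c : S) : c ^ p ≠ algebraMap K S x :=
  fun hc => not_isReduced_tensor_adjoinRoot_of_pow_eq p x hc hred

end Fibre

/-! ## §2 The purity half -/

section Purity

variable {A B : Type*} [CommRing A] [IsDomain A] [CommRing B] [Algebra A B]

/-- **The purity half.**  `A` a domain, `B` a reduced `A`-algebra of prime characteristic `p`, pure for principal ideals
(`algebraMap a ∈ (algebraMap b) B ⟹ a ∈ bA`).  If `a^p = x·b^p` in `A` with `b ≠ 0` (so `x = (a/b)^p` in `Frac A`) and `x` is a `p`-th power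
in `B`, then `x` is a `p`-th power in `A`. [folklore] -/
theorem exists_pow_eq_of_pow_eq_mul_pow (p : ℕ) [Fact p.Prime] [CharP B p] [IsReduced B]
    (hpure : ∀ a b : A, algebraMap A B a ∈ Ideal.span {algebraMap A B b} → a ∈ Ideal.span {b})
    {x a b : A} (hb : b ≠ 0) (hab : a ^ p = x * b ^ p) {g' : B} (hg' : g' ^ p = algebraMap A B x) :
    ∃ g : A, g ^ p = x := by
  -- in `B`: `(algebraMap a)^p = (g' · algebraMap b)^p`, so `algebraMap a = g' · algebraMap b`
  have h1 : (algebraMap A B a) ^ p = (g' * algebraMap A B b) ^ p := by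
    rw [← map_pow, hab, map_mul, map_pow, mul_pow, hg']
  have h2 : algebraMap A B a = g' * algebraMap A B b := frobenius_inj B p h1
  have hmem : algebraMap A B a ∈ Ideal.span {algebraMap A B b} :=
    Ideal.mem_span_singleton'.mpr ⟨g', h2.symm⟩
  obtain ⟨g, hg⟩ := Ideal.mem_span_singleton'.mp (hpure a b hmem)
  refine ⟨g, ?_⟩
  have h3 : (g ^ p - x) * b ^ p = 0 := by
    rw [sub_mul, ← mul_pow, hg, hab, sub_self]
  rcases mul_eq_zero.mp h3 with h | h
  · exact sub_eq_zero.mp h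
  · exact absurd (pow_eq_zero_iff (Fact.out : p.Prime).ne_zero |>.mp h) hb

omit [IsDomain A] in
/-- Faithfully flat algebras are pure for principal ideals (`bB ∩ A = bA`; Mathlib's `Ideal.comap_map_eq_self_of_faithfullyFlat`).
[folklore] -/
theorem mem_span_singleton_of_faithfullyFlat [Module.FaithfullyFlat A B] (a b : A)
    (h : algebraMap A B a ∈ Ideal.span {algebraMap A B b}) : a ∈ Ideal.span {b} := by
  have hmap : (Ideal.span {b}).map (algebraMap A B) = Ideal.span {algebraMap A B b} := by
    rw [Ideal.map_span, Set.image_singleton]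
  have ha : a ∈ ((Ideal.span {b}).map (algebraMap A B)).comap (algebraMap A B) := by
    rw [Ideal.mem_comap, hmap]; exact h
  rwa [Ideal.comap_map_eq_self_of_faithfullyFlat] at ha

end Purity

/-! ## §3 The descent -/

section Descent

variable {A K B : Type*} [CommRing A] [IsDomain A] [Field K] [Algebra A K] [IsFractionRing A K]
  [CommRing B] [Algebra A B]

/-- **`p`-th powers descend.**  `A` a domain with fraction field `K`, `B` a reduced `A`-algebra of prime characteristic `p`, pure for
principal ideals, with `K ⊗[A] B` non-trivial, and such that — in case `x` is not a `p`-th power in `K` — the fibre ring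
`(K ⊗[A] B) ⊗[K] K[T]/(T^p − x)` is reduced (geometric reducedness of the generic fibre against `x^{1/p}`).  If `x ∈ A` is a `p`-th power
in `B`, then `x` is a `p`-th power in `A`.  (Instance: `B = Â` for a local domain `A` which is a G-ring.) [folklore] -/
theorem exists_pow_eq_of_pow_eq_algebraMap (p : ℕ) [Fact p.Prime] [CharP K p] [CharP B p] [IsReduced B]
    [Nontrivial (K ⊗[A] B)]
    (hpure : ∀ a b : A, algebraMap A B a ∈ Ideal.span {algebraMap A B b} → a ∈ Ideal.span {b})
    {x : A}
    (hfib : (∀ y : K, y ^ p ≠ algebraMap A K x) →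
      IsReduced ((K ⊗[A] B) ⊗[K] AdjoinRoot (X ^ p - C (algebraMap A K x) : K[X])))
    {g' : B} (hg' : g' ^ p = algebraMap A B x) : ∃ g : A, g ^ p = x := by
  by_cases hK : ∃ y : K, y ^ p = algebraMap A K x
  · -- `x ∈ K^p`: clear denominators and use purity
    obtain ⟨y, hy⟩ := hK
    obtain ⟨a, b, hb, rfl⟩ := IsFractionRing.div_surjective (A := A) y
    have hb0 : b ≠ 0 := nonZeroDivisors.ne_zero hb
    have hbK : algebraMap A K b ≠ 0 := IsFractionRing.to_map_ne_zero_of_mem_nonZeroDivisors hb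
    have hab : a ^ p = x * b ^ p := by
      apply IsFractionRing.injective A K
      rw [map_pow, map_mul, map_pow, ← hy, div_pow, div_mul_cancel₀ _ (pow_ne_zero _ hbK)]
    exact exists_pow_eq_of_pow_eq_mul_pow p hpure hb0 hab hg'
  · -- `x ∉ K^p`: the image of `g'` in `K ⊗ B` is a `p`-th root of `x`, contradicting the reduced fibre
    push Not at hK
    have hred := hfib hK
    exfalso
    refine forall_pow_ne_of_isReduced_tensor_adjoinRoot p (algebraMap A K x) hred ((1 : K) ⊗ₜ[A] g') ?_
    rw [Algebra.TensorProduct.tmul_pow, one_pow, hg', Algebra.TensorProduct.algebraMap_apply, Algebra.algebraMap_self,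
      RingHom.id_apply, Algebra.algebraMap_eq_smul_one x, Algebra.algebraMap_eq_smul_one x, tmul_smul, smul_tmul']

/-- **`p`-th powers descend along faithfully flat reduced algebras with geometrically reduced generic fibre** — the same with
purity supplied by `Module.FaithfullyFlat A B`. [folklore] -/
theorem exists_pow_eq_of_pow_eq_algebraMap_of_faithfullyFlat (p : ℕ) [Fact p.Prime] [CharP K p] [CharP B p] [IsReduced B]
    [Module.FaithfullyFlat A B] [Nontrivial (K ⊗[A] B)] {x : A}
    (hfib : (∀ y : K, y ^ p ≠ algebraMap A K x) →
      IsReduced ((K ⊗[A] B) ⊗[K] AdjoinRoot (X ^ p - C (algebraMap A K x) : K[X])))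
    {g' : B} (hg' : g' ^ p = algebraMap A B x) : ∃ g : A, g ^ p = x :=
  exists_pow_eq_of_pow_eq_algebraMap p mem_span_singleton_of_faithfullyFlat hfib hg'

end Descent

end Summit.ResolutionOfSingularities.ResolutionOfSingularities.Theorems.RadicialJung.CleanModels
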